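import Mathlib
import Summits.ValiantsHypothesis.ValiantsHypothesis.Theorems.DivisionGapPerMultiplesHardStubSharpSubSupportCount
import Literature.Computability.AlgebraicComplexity.PermanentIrreducible

/-!
# `DivisionGap.PerMultiplesHard` (stmt-ValiantsHypothesis-5068), line `uncharged-face-walk`:
Jerrum–Snir by SUB-support, RELATIVE form (stub `stub_subSupportCountRel`)

For `m ≥ 3`, every `p` over `ℝ≥0` all of whose monomials are permutation monomials
(`supp p ⊆ supp per_m`) and EVERY comparison set `P` of permutations of `Fin m` there are a column
set `T` in the degree window `m < 3 · #T ≤ 2m` and a row set `S` with `#S = #T` such that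

  `#{π ∈ P : μ_π ∈ supp p} ≤ L⁺(p) · #{π ∈ P : π(T) = S}`,

for the tree's monotone fan-in-two `complexity` `L⁺` over `ℝ≥0` (`μ_π = permMonomial π`, cells
`(π j, j) = (row, column)`).

Mechanism (the absolute version is `SharpSubSupportCount.stub_sharpSubSupportCount`, with
`Finset.univ` replaced by `P` and the binomial replaced by one fibre `{π : π(T) = S}`):
1. `supp p ⊆ supp per_m` makes `p` homogeneous of degree `m`, so a minimal fan-in-two circuit for
   `p` writes `p = Σ_t a_t b_t` with `≤ L⁺(p)` terms and `deg a_t ∈ (m/3, 2(m/3)]`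
   (`exists_decomposition`, `exists_computes_size_eq_complexity`, `prodCount_le_size`).
2. No cancellation over `ℝ≥0`: `supp (a_t b_t) = supp a_t + supp b_t ⊆ supp p ⊆ supp per_m`.
   KEY LEMMA (`image_eq_of_mem_support_mul`): if `a, b ≠ 0` and `supp (a b) ⊆ supp per_m` then all
   exponents of `b` have the column counts and row counts of one fixed `b₀ ∈ supp b` (they all
   complete the same `a₀ ∈ supp a` to a permutation matrix), so with `T` / `S` the columns / rows
   NOT met by `b₀` (`#T = #S = deg a₀ = deg a`), every `μ_π = x + y ∈ supp a + supp b` has the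
   cells of `x` exactly at `(π j, j)`, `j ∈ T`, whence `π(T) ⊆ S` and, by cardinality, `π(T) = S`.
3. Hence `{π ∈ P : μ_π ∈ supp p} ⊆ ⋃_t {π ∈ P : μ_π ∈ supp (a_t b_t)} ⊆ ⋃_t {π ∈ P : π(T_t) = S_t}`,
   of total size `≤ #terms · max_t ≤ L⁺(p) · #{π ∈ P : π(T_t) = S_t}` for a maximising `t`
   (`Finset.exists_max_image`); terms with `b_t = 0` and the case of no terms contribute nothing,
   and then any `⌊m/3⌋ + 1` columns `T` with `S := T` are a window (`exists_window_set`).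
4. Window arithmetic: `deg a_t ≥ m/3 + 1 ⇒ 3 deg a_t > m`, `deg a_t ≤ 2(m/3) ⇒ 3 deg a_t ≤ 2m`.

-- adapted from Theorems/DivisionGapPerMultiplesHardStubSharpSubSupportCount.lean
-- (`card_support_mul_choose_le_prodCount_mul`, `stub_sharpSubSupportCount`) and from
-- Literature/Barriers/ValiantsHypothesis/MonotoneGapPermanentLower.lean
-- (`JerrumSnir.card_le_factorial_of_add_mem`: the common column set of one block).
[cite: JerrumSnir1982, §4.3 (p. 887–888) and Cor. 3.5]
-/

noncomputable section

-- the namespace `Summit.ValiantsHypothesis.ValiantsHypothesis.…` is mandated by the crux (registered stub names)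
set_option linter.dupNamespace false

namespace Summit.ValiantsHypothesis.ValiantsHypothesis.Theorems.DivisionGap.PerMultiplesHard.SubSupportCountRel

open MvPolynomial Literature.Computability.AlgebraicComplexity
open scoped NNReal BigOperators
open Literature.Barriers.ValiantsHypothesis

variable {m : ℕ}

/-! ### Summands of a permutation monomial -/

/-- The degree of an exponent vector on `Fin m × Fin m` is the sum of its row counts. [folklore] -/
theorem degree_eq_sum_rowCount (x : Fin m × Fin m →₀ ℕ) : x.degree = ∑ i, rowCount x i := by
  unfold rowCount
  rw [Finsupp.degree_eq_sum, Fintype.sum_prod_type]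

/-- A summand `x` of a permutation monomial `μ_π = x + y` vanishes off the cells `(π c, c)`.
[folklore] -/
theorem apply_eq_zero_of_add_eq_permMonomial {x y : Fin m × Fin m →₀ ℕ} {π : Equiv.Perm (Fin m)}
    (h : x + y = permMonomial π) {r c : Fin m} (hrc : π c ≠ r) : x (r, c) = 0 := by
  have hcell := DFunLike.congr_fun h (r, c)
  rw [Finsupp.add_apply, permMonomial_apply, if_neg hrc] at hcell
  omega

/-- The column count of a summand `x` of `μ_π = x + y` at column `c` is its entry at `(π c, c)`.
[folklore] -/
theorem colCount_eq_apply_of_add_eq_permMonomial {x y : Fin m × Fin m →₀ ℕ}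
    {π : Equiv.Perm (Fin m)} (h : x + y = permMonomial π) (c : Fin m) :
    colCount x c = x (π c, c) := by
  unfold colCount
  rw [Finset.sum_eq_single (π c)]
  · intro r _ hr
    exact apply_eq_zero_of_add_eq_permMonomial h (Ne.symm hr)
  · intro hc
    exact absurd (Finset.mem_univ _) hc

/-- The row count of a summand `x` of `μ_π = x + y` at row `r` is its entry at `(r, π⁻¹ r)`.
[folklore] -/
theorem rowCount_eq_apply_of_add_eq_permMonomial {x y : Fin m × Fin m →₀ ℕ}
    {π : Equiv.Perm (Fin m)} (h : x + y = permMonomial π) (r : Fin m) :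
    rowCount x r = x (r, π.symm r) := by
  unfold rowCount
  rw [Finset.sum_eq_single (π.symm r)]
  · intro c _ hc
    refine apply_eq_zero_of_add_eq_permMonomial h fun hcr => hc ?_
    rw [← hcr, Equiv.symm_apply_apply]
  · intro hr
    exact absurd (Finset.mem_univ _) hr

/-- Column counts of the two summands of a permutation monomial add up to `1`. [folklore] -/
theorem colCount_add_colCount_eq_one {x y : Fin m × Fin m →₀ ℕ} {π : Equiv.Perm (Fin m)}
    (h : x + y = permMonomial π) (c : Fin m) : colCount x c + colCount y c = 1 := by
  rw [← colCount_add, h, colCount_permMonomial]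

/-- Row counts of the two summands of a permutation monomial add up to `1`. [folklore] -/
theorem rowCount_add_rowCount_eq_one {x y : Fin m × Fin m →₀ ℕ} {π : Equiv.Perm (Fin m)}
    (h : x + y = permMonomial π) (r : Fin m) : rowCount x r + rowCount y r = 1 := by
  rw [← rowCount_add, h, rowCount_permMonomial]

/-! ### The key lemma: one common column set and one common row set per product -/

-- adapted from Literature/Barriers/ValiantsHypothesis/MonotoneGapPermanentLower.lean
-- (`JerrumSnir.card_le_factorial_of_add_mem`) and PerDivisionHard/Negative/PerSupportBound.lean
-- (`card_support_mul_choose_le`, the computation of `a.totalDegree`)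
/-- **Key lemma (rectangles of the permanent are typed).**  If `a, b ≠ 0` over `ℝ≥0` and every
monomial of `a · b` is a permutation monomial, then there are a row set `S` and a column set `T`,
`#S = #T = deg a`, such that every permutation `π` with `μ_π ∈ supp (a · b)` maps `T` onto `S`:
all monomials of `b` complete a fixed `a₀ ∈ supp a` to a permutation matrix, so they share the
column counts and row counts of a fixed `b₀ ∈ supp b`; `T` / `S` are the columns / rows missed by
`b₀`; and if `μ_π = x + y`, `x ∈ supp a`, `y ∈ supp b`, then for `j ∈ T` the only cell of `x` in
column `j` is `(π j, j)`, so row `π j` is met by `x`, i.e. missed by `y`, i.e. `π j ∈ S`; equality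
`π(T) = S` follows from `#π(T) = #T = #S`. [cite: JerrumSnir1982, §4.3 (p. 887–888)] -/
theorem image_eq_of_mem_support_mul {a b : MvPolynomial (Fin m × Fin m) ℝ≥0}
    (hab : (a * b).support ⊆ (perPoly (Fin m) ℝ≥0).support) (ha : a ≠ 0) (hb : b ≠ 0) :
    ∃ S T : Finset (Fin m), T.card = a.totalDegree ∧ S.card = T.card ∧
      ∀ π : Equiv.Perm (Fin m), permMonomial π ∈ (a * b).support → T.image ⇑π = S := by
  classical
  obtain ⟨a₀, ha₀⟩ := exists_coeff_ne_zero ha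
  obtain ⟨b₀, hb₀⟩ := exists_coeff_ne_zero hb
  have ha₀s : a₀ ∈ a.support := mem_support_iff.mpr ha₀
  have hb₀s : b₀ ∈ b.support := mem_support_iff.mpr hb₀
  -- every pair of monomials glues to a permutation monomial
  have hpair : ∀ x ∈ a.support, ∀ y ∈ b.support,
      ∃ σ : Equiv.Perm (Fin m), x + y = permMonomial σ := by
    intro x hx y hy
    have hxy : x + y ∈ (perPoly (Fin m) ℝ≥0).support :=
      hab (by rw [JerrumSnir.support_mul_eq]; exact Finset.add_mem_add hx hy)
    obtain ⟨σ, hσ⟩ := (JerrumSnir.mem_support_perPoly ℝ≥0).1 hxy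
    exact ⟨σ, hσ.symm⟩
  obtain ⟨σ₀, hσ₀⟩ := hpair a₀ ha₀s b₀ hb₀s
  -- all monomials of `b` have the column counts and the row counts of `b₀`
  have hcolb : ∀ y ∈ b.support, ∀ j, colCount y j = colCount b₀ j := by
    intro y hy j
    obtain ⟨σ, hσ⟩ := hpair a₀ ha₀s y hy
    have h1 := colCount_add_colCount_eq_one hσ j
    have h2 := colCount_add_colCount_eq_one hσ₀ j
    omega
  have hrowb : ∀ y ∈ b.support, ∀ i, rowCount y i = rowCount b₀ i := by
    intro y hy i
    obtain ⟨σ, hσ⟩ := hpair a₀ ha₀s y hy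
    have h1 := rowCount_add_rowCount_eq_one hσ i
    have h2 := rowCount_add_rowCount_eq_one hσ₀ i
    omega
  -- the columns `T` and the rows `S` missed by `b₀`; `deg a₀ = #T = #S`
  set T : Finset (Fin m) := Finset.univ.filter fun j : Fin m => colCount b₀ j = 0 with hT
  set S : Finset (Fin m) := Finset.univ.filter fun i : Fin m => rowCount b₀ i = 0 with hS
  have hdegT : a₀.degree = T.card := by
    rw [JerrumSnir.degree_eq_sum_colCount, hT, Finset.card_filter]
    refine Finset.sum_congr rfl fun j _ => ?_
    have h1 := colCount_add_colCount_eq_one hσ₀ j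
    by_cases h0 : colCount b₀ j = 0
    · rw [if_pos h0]; omega
    · rw [if_neg h0]; omega
  have hdegS : a₀.degree = S.card := by
    rw [degree_eq_sum_rowCount, hS, Finset.card_filter]
    refine Finset.sum_congr rfl fun i _ => ?_
    have h1 := rowCount_add_rowCount_eq_one hσ₀ i
    by_cases h0 : rowCount b₀ i = 0
    · rw [if_pos h0]; omega
    · rw [if_neg h0]; omega
  -- all monomials of `a` have degree `deg a₀`, which is therefore the total degree of `a`
  have hdegx : ∀ x ∈ a.support, x.degree = a₀.degree := by
    intro x hx
    obtain ⟨σ, hσ⟩ := hpair x hx b₀ hb₀s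
    have h1 : (x + b₀).degree = m := by rw [hσ]; exact JerrumSnir.degree_permMonomial σ
    have h2 : (a₀ + b₀).degree = m := by rw [hσ₀]; exact JerrumSnir.degree_permMonomial σ₀
    rw [map_add] at h1 h2
    omega
  have hsum : ∀ s : (Fin m × Fin m) →₀ ℕ, (s.sum fun _ e => e) = s.degree := fun s => by
    rw [Finsupp.degree_apply]; rfl
  have htot : a.totalDegree = a₀.degree := by
    apply le_antisymm
    · rw [MvPolynomial.totalDegree]
      refine Finset.sup_le fun x hx => ?_
      rw [hsum, hdegx x hx]
    · have := le_totalDegree ha₀s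
      rwa [hsum] at this
  refine ⟨S, T, by rw [htot, hdegT], by rw [← hdegS, hdegT], ?_⟩
  -- `μ_π = x + y`, `x ∈ supp a`, `y ∈ supp b`: then `π(T) ⊆ S`
  intro π hπ
  rw [JerrumSnir.support_mul_eq] at hπ
  obtain ⟨x, hx, y, hy, hxy⟩ := Finset.mem_add.1 hπ
  have hsub : T.image ⇑π ⊆ S := by
    intro i hi
    obtain ⟨j, hj, rfl⟩ := Finset.mem_image.1 hi
    have hjT : colCount b₀ j = 0 := (Finset.mem_filter.1 hj).2
    -- column `j` is met by `x`, at the cell `(π j, j)`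
    have hcx : colCount x j = 1 := by
      have h1 := colCount_add_colCount_eq_one hxy j
      rw [hcolb y hy j] at h1
      omega
    have hcell : x (π j, j) = 1 := by
      rwa [colCount_eq_apply_of_add_eq_permMonomial hxy j] at hcx
    -- so row `π j` is met by `x`, hence missed by `y` and by `b₀`
    have hrx : rowCount x (π j) = 1 := by
      rw [rowCount_eq_apply_of_add_eq_permMonomial hxy (π j), Equiv.symm_apply_apply]
      exact hcell
    have hry : rowCount b₀ (π j) = 0 := by
      have h1 := rowCount_add_rowCount_eq_one hxy (π j)
      rw [hrowb y hy] at h1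
      omega
    exact Finset.mem_filter.2 ⟨Finset.mem_univ _, hry⟩
  -- and `#π(T) = #T = #S`
  refine Finset.eq_of_subset_of_card_le hsub ?_
  rw [Finset.card_image_of_injective _ π.injective, ← hdegS, hdegT]

/-! ### Counting inside a comparison set `P` -/

/-- The `P`-part served by a sum is served by the summands: `supp (f + g) ⊆ supp f ∪ supp g`.
[folklore] -/
theorem card_filter_mem_support_add_le (P : Finset (Equiv.Perm (Fin m)))
    (f g : MvPolynomial (Fin m × Fin m) ℝ≥0) :
    (P.filter fun π : Equiv.Perm (Fin m) => permMonomial π ∈ (f + g).support).card ≤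
      (P.filter fun π : Equiv.Perm (Fin m) => permMonomial π ∈ f.support).card +
        (P.filter fun π : Equiv.Perm (Fin m) => permMonomial π ∈ g.support).card := by
  calc (P.filter fun π : Equiv.Perm (Fin m) => permMonomial π ∈ (f + g).support).card
      ≤ ((P.filter fun π : Equiv.Perm (Fin m) => permMonomial π ∈ f.support) ∪
          (P.filter fun π : Equiv.Perm (Fin m) => permMonomial π ∈ g.support)).card := by
        refine Finset.card_le_card fun π hπ => ?_
        rw [Finset.mem_filter] at hπ
        rw [Finset.mem_union, Finset.mem_filter, Finset.mem_filter]
        rcases Finset.mem_union.1 (support_add hπ.2) with h | h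
        · exact Or.inl ⟨hπ.1, h⟩
        · exact Or.inr ⟨hπ.1, h⟩
    _ ≤ _ := Finset.card_union_le _ _

/-- The `P`-part served by a sum of products is at most the sum of the `P`-parts served by the
products. [folklore] -/
theorem card_filter_mem_support_sum_le (P : Finset (Equiv.Perm (Fin m)))
    (L : List (MvPolynomial (Fin m × Fin m) ℝ≥0 × MvPolynomial (Fin m × Fin m) ℝ≥0)) :
    (P.filter fun π : Equiv.Perm (Fin m) => permMonomial π ∈
        (L.map fun ab : MvPolynomial (Fin m × Fin m) ℝ≥0 × MvPolynomial (Fin m × Fin m) ℝ≥0 =>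
          ab.1 * ab.2).sum.support).card ≤
      (L.map fun ab => (P.filter fun π : Equiv.Perm (Fin m) =>
        permMonomial π ∈ (ab.1 * ab.2).support).card).sum := by
  induction L with
  | nil => simp
  | cons ab L ih =>
    simp only [List.map_cons, List.sum_cons]
    exact (card_filter_mem_support_add_le P _ _).trans (Nat.add_le_add_left ih _)

/-- **A window set exists.**  For `m ≥ 3` there is a set `T` of columns with `m < 3 · #T ≤ 2m`:
any `⌊m/3⌋ + 1` columns (`3(⌊m/3⌋ + 1) > m` and `3(⌊m/3⌋ + 1) ≤ m + 3 ≤ 2m`). [folklore] -/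
theorem exists_window_set (hm : 3 ≤ m) :
    ∃ T : Finset (Fin m), m < 3 * T.card ∧ 3 * T.card ≤ 2 * m := by
  classical
  have hle : m / 3 + 1 ≤ (Finset.univ : Finset (Fin m)).card := by
    rw [Finset.card_univ, Fintype.card_fin]; omega
  obtain ⟨T, -, hT⟩ := Finset.exists_subset_card_eq hle
  exact ⟨T, by rw [hT]; omega, by rw [hT]; omega⟩

/-! ### The stub -/

/-- **stub_subSupportCountRel — Jerrum–Snir by sub-support, RELATIVE.**  For `m ≥ 3`,
`supp p ⊆ supp per_m` and ANY comparison set `P` of permutations there are a column set `T` in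
the degree window `m < 3·#T ≤ 2m` and a row set `S` of the same size with
`#{π ∈ P : μ_π ∈ supp p} ≤ L⁺(p) · #{π ∈ P : π(T) = S}`: decompose `p = Σ_t a_t b_t` by a
minimal fan-in-two circuit (`exists_decomposition`, `deg a_t ∈ (m/3, 2(m/3)]`, at most `L⁺(p)`
terms); each term's `P`-part lies in one fibre `{π ∈ P : π(T_t) = S_t}` with `#T_t = deg a_t`
(`image_eq_of_mem_support_mul`; terms with `b_t = 0` serve nothing); the `P`-part of `p` is
covered by the terms' parts (`card_filter_mem_support_sum_le`), so it is at most
`#terms · max_t ≤ L⁺(p) · max_t`; take a maximising term (`Finset.exists_max_image`), or any window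
set with `S := T` if there are no terms. [cite: JerrumSnir1982, §4.3 and Cor. 3.5] -/
theorem stub_subSupportCountRel :
    ∀ (m : ℕ), 3 ≤ m → ∀ (p : MvPolynomial (Fin m × Fin m) ℝ≥0),
      p.support ⊆ (perPoly (Fin m) ℝ≥0).support →
      ∀ P : Finset (Equiv.Perm (Fin m)), ∃ S T : Finset (Fin m),
        m < 3 * T.card ∧ 3 * T.card ≤ 2 * m ∧ S.card = T.card ∧
        (P.filter fun π => permMonomial π ∈ p.support).card ≤
          complexity p * (P.filter fun π : Equiv.Perm (Fin m) => T.image ⇑π = S).card := by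
  intro m hm p hp P
  classical
  -- `p` is homogeneous of degree `m`
  have hhom : p.IsHomogeneous m := by
    intro e he
    have he' : e ∈ (perPoly (Fin m) ℝ≥0).support := hp (mem_support_iff.mpr he)
    have := perPoly_isHomogeneous (n := Fin m) (k := ℝ≥0) (mem_support_iff.mp he')
    rwa [Fintype.card_fin] at this
  have hm1 : 1 ≤ m / 3 := by omega
  have hmN : m / 3 < m := by omega
  -- a minimal circuit and its balanced decomposition
  obtain ⟨C, h2, hC, hsize⟩ := ArithCircuit.exists_computes_size_eq_complexity p
  have heval : C.eval = p := hC
  obtain ⟨L, hLlen, hLsum, hLdeg⟩ :=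
    Literature.Barriers.ValiantsHypothesis.exists_decomposition hm1 hmN _ C le_rfl h2
      (by rw [heval]; exact hhom)
  rw [heval] at hLsum
  have hLc : L.length ≤ complexity p := hLlen.trans (hsize ▸ prodCount_le_size C)
  -- each term serves, inside `P`, at most one fibre of a window type
  have hterm : ∀ ab ∈ L, ∃ S T : Finset (Fin m),
      m < 3 * T.card ∧ 3 * T.card ≤ 2 * m ∧ S.card = T.card ∧
        (P.filter fun π : Equiv.Perm (Fin m) => permMonomial π ∈ (ab.1 * ab.2).support).card ≤
          (P.filter fun π : Equiv.Perm (Fin m) => T.image ⇑π = S).card := by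
    intro ab hab
    by_cases hb : ab.2 = 0
    · obtain ⟨T, hT1, hT2⟩ := exists_window_set hm
      refine ⟨T, T, hT1, hT2, rfl, ?_⟩
      rw [hb, mul_zero, support_zero]
      simp
    have hdeg := hLdeg ab hab
    have ha : ab.1 ≠ 0 := by
      intro ha
      rw [ha, totalDegree_zero] at hdeg
      omega
    have hsub : (ab.1 * ab.2).support ⊆ (perPoly (Fin m) ℝ≥0).support := by
      obtain ⟨q, hq⟩ := exists_sum_eq_add_of_mem (fun ab : MvPolynomial _ ℝ≥0 × _ => ab.1 * ab.2)
        L ab hab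
      exact (support_subset_of_eq_add (hLsum.trans hq)).trans hp
    obtain ⟨S, T, hT, hST, hfib⟩ := image_eq_of_mem_support_mul hsub ha hb
    refine ⟨S, T, by rw [hT]; omega, by rw [hT]; omega, hST, Finset.card_le_card fun π hπ => ?_⟩
    rw [Finset.mem_filter] at hπ ⊢
    exact ⟨hπ.1, hfib π hπ.2⟩
  -- the `P`-part of `p` is covered by the terms' parts
  have hcover : (P.filter fun π : Equiv.Perm (Fin m) => permMonomial π ∈ p.support).card ≤
      (L.map fun ab => (P.filter fun π : Equiv.Perm (Fin m) =>
        permMonomial π ∈ (ab.1 * ab.2).support).card).sum := by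
    rw [hLsum]
    exact card_filter_mem_support_sum_le P L
  by_cases hL : L = []
  · -- no terms: nothing is served
    subst hL
    obtain ⟨T, hT1, hT2⟩ := exists_window_set hm
    refine ⟨T, T, hT1, hT2, rfl, ?_⟩
    simp only [List.map_nil, List.sum_nil] at hcover
    exact hcover.trans (Nat.zero_le _)
  -- a maximising term
  have hne : L.toFinset.Nonempty := by
    obtain ⟨ab, hab⟩ := List.exists_mem_of_ne_nil L hL
    exact ⟨ab, List.mem_toFinset.2 hab⟩
  obtain ⟨ab₀, hab₀, hmax⟩ := Finset.exists_max_image L.toFinset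
    (fun ab : MvPolynomial (Fin m × Fin m) ℝ≥0 × MvPolynomial (Fin m × Fin m) ℝ≥0 =>
      (P.filter fun π : Equiv.Perm (Fin m) => permMonomial π ∈ (ab.1 * ab.2).support).card) hne
  rw [List.mem_toFinset] at hab₀
  obtain ⟨S, T, hT1, hT2, hST, hfib⟩ := hterm ab₀ hab₀
  refine ⟨S, T, hT1, hT2, hST, ?_⟩
  calc (P.filter fun π : Equiv.Perm (Fin m) => permMonomial π ∈ p.support).card
      ≤ (L.map fun ab => (P.filter fun π : Equiv.Perm (Fin m) =>
          permMonomial π ∈ (ab.1 * ab.2).support).card).sum := hcover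
    _ ≤ (L.map fun _ => (P.filter fun π : Equiv.Perm (Fin m) =>
          permMonomial π ∈ (ab₀.1 * ab₀.2).support).card).sum :=
        List.sum_le_sum fun ab hab => hmax ab (List.mem_toFinset.2 hab)
    _ = L.length * (P.filter fun π : Equiv.Perm (Fin m) =>
          permMonomial π ∈ (ab₀.1 * ab₀.2).support).card := by
        rw [List.map_const', List.sum_replicate, smul_eq_mul]
    _ ≤ complexity p * (P.filter fun π : Equiv.Perm (Fin m) => T.image ⇑π = S).card :=
        Nat.mul_le_mul hLc hfib

end Summit.ValiantsHypothesis.ValiantsHypothesis.Theorems.DivisionGap.PerMultiplesHard.SubSupportCountRel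

end
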